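import Mathlib

/-!
# Crux DiffuseBackwardInfluence (stmt-AtomisticToContinuum-12950) — idea `coalescing-influence-tracers`
First lemmas (abstract, pathwise, PROVED): the COALESCENT BOUND for an exchange sequence.

Dictionary to the crux.  Fix a source particle `i` (column picture, forward in time; rows are symmetric,
`Σ_{i,k} ‖M_ik‖_F⁴` is invariant under transposition).  Along the realised collision sequence of the window
the block weights `μ(m) := ‖M_{m i}‖_F² / 3` (`M` = the crux's frozen-geometry transfer built so far) evolve,
at a collision of hosts `k ≠ l` with normal `ω`, by the exchange step `massStep` with the ADAPTED fractions
`p = ‖P_ω M_{k i}‖_F² / ‖M_{k i}‖_F²`, `q = ‖P_ω M_{l i}‖_F² / ‖M_{l i}‖_F²` (exact: the cross terms vanish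
because `P_ω (1 - P_ω) = 0`; this one-step bookkeeping is already machine-checked on this item as
`kinship_step` / `GainProof.gainIdentity`).  Hence `μ` is the law of ONE "influence tracer" (a host-valued
chain jumping `k → l` w.p. `p` at that collision), `Σ_m μ(m)² = (column-ipr of i) / 9` is the probability
that TWO conditionally independent tracers sit on the same host, `ν` is the mass of tracer pairs that never
split, `A` the mass of pairs that are together again after at least one split (fed ONLY when the two current
hosts COLLIDE WITH EACH OTHER, and killed by the same split hazard as `ν`), and `B` the crude total of all
merges.  The lemmas hold for ARBITRARY adapted fractions in `[0,1]` — no randomness of the normals is used;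
the measure enters only afterwards, in bounding `E[Σν]` (one path) and `E[ΣA]` (two paths, late re-touches).
-/

namespace Summit.AtomisticToContinuum.HydrodynamicLimit.Cruxes.DiffuseBackwardInfluence.CoalescingTracers

open Finset BigOperators

/-- One exchange event: hosts `k`, `l` swap the mass fractions `p` (`k → l`) and `q` (`l → k`). -/
structure Event (n : ℕ) where
  k : Fin n
  l : Fin n
  p : ℝ
  q : ℝ

/-- Tracer law update (= block-weight bookkeeping of one column/row of the transfer). -/
def massStep {n : ℕ} (μ : Fin n → ℝ) (e : Event n) : Fin n → ℝ := fun m =>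
  if m = e.k then (1 - e.p) * μ e.k + e.q * μ e.l
  else if m = e.l then (1 - e.q) * μ e.l + e.p * μ e.k
  else μ m

/-- Never-split mass of the tracer PAIR (both stay: `(1-p)²`, both jump: `p²`). -/
def nsStep {n : ℕ} (ν : Fin n → ℝ) (e : Event n) : Fin n → ℝ := fun m =>
  if m = e.k then (1 - e.p) ^ 2 * ν e.k + e.q ^ 2 * ν e.l
  else if m = e.l then (1 - e.q) ^ 2 * ν e.l + e.p ^ 2 * ν e.k
  else ν m

/-- Mass that merges at this event: apart pairs on `(k,l)` or `(l,k)` (mass `μ k * μ l` each, the pair law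
being the product law) of which exactly one tracer crosses. -/
def mergeStep {n : ℕ} (μ : Fin n → ℝ) (e : Event n) : ℝ :=
  2 * μ e.k * μ e.l * (e.p * (1 - e.q) + e.q * (1 - e.p))

/-- Re-merged mass: pairs together now that have split before.  It decays by the same hazard as the
never-split mass and is fed by the merges of this event. -/
def aStep {n : ℕ} (μ A : Fin n → ℝ) (e : Event n) : Fin n → ℝ := fun m =>
  if m = e.k then (1 - e.p) ^ 2 * A e.k + e.q ^ 2 * A e.l + 2 * (1 - e.p) * e.q * (μ e.k * μ e.l)
  else if m = e.l then (1 - e.q) ^ 2 * A e.l + e.p ^ 2 * A e.k + 2 * e.p * (1 - e.q) * (μ e.k * μ e.l)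
  else A m

/-- State carried along the collision sequence: (tracer law, never-split mass, re-merged mass, crude merge
total). -/
abbrev State (n : ℕ) := (Fin n → ℝ) × (Fin n → ℝ) × (Fin n → ℝ) × ℝ

/-- One step of the bookkeeping. -/
def run {n : ℕ} (s : State n) (e : Event n) : State n :=
  (massStep s.1 e, nsStep s.2.1 e, aStep s.1 s.2.2.1 e, s.2.2.2 + mergeStep s.1 e)

/-- Initial state for the source `i`: tracer law `δ_i`, never-split `δ_i`, re-merged `0`, merges `0`. -/
def init {n : ℕ} (i : Fin n) : State n := (Pi.single i 1, Pi.single i 1, fun _ => 0, 0)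

/-- Admissible events: distinct hosts, fractions in `[0,1]` (for the transfer: `p = ‖P_ω c_k‖²/‖c_k‖² ∈ [0,1]`). -/
def Admissible {n : ℕ} (e : Event n) : Prop :=
  e.k ≠ e.l ∧ 0 ≤ e.p ∧ e.p ≤ 1 ∧ 0 ≤ e.q ∧ e.q ≤ 1

/-! ### Exact bookkeeping identities -/

/-- Sum of a function modified at two distinct points. [folklore] -/
theorem sum_twoPoint {n : ℕ} {k l : Fin n} (hkl : k ≠ l) (f g : Fin n → ℝ) (a b : ℝ)
    (hg : ∀ m, g m = if m = k then a else if m = l then b else f m) :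
    ∑ m, g m = ∑ m, f m + (a - f k) + (b - f l) := by
  have h : ∀ m, g m = f m + (if m = k then a - f k else 0) + (if m = l then b - f l else 0) := by
    intro m
    rw [hg m]
    by_cases hk : m = k
    · rw [if_pos hk, if_pos hk, if_neg (fun hl => hkl (hk.symm.trans hl)), hk]; ring
    · rw [if_neg hk, if_neg hk]
      by_cases hl : m = l
      · rw [if_pos hl, if_pos hl, hl]; ring
      · rw [if_neg hl, if_neg hl]; ring
  calc ∑ m, g m = ∑ m, (f m + (if m = k then a - f k else 0) + (if m = l then b - f l else 0)) :=
        Finset.sum_congr rfl (fun m _ => h m)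
    _ = ∑ m, f m + ∑ m, (if m = k then a - f k else 0) + ∑ m, (if m = l then b - f l else 0) := by
        rw [Finset.sum_add_distrib, Finset.sum_add_distrib]
    _ = ∑ m, f m + (a - f k) + (b - f l) := by simp

/-- **Mass transport.** The tracer law stays a probability vector (row/column budget of the transfer:
`Σ_m ‖M_{m i}‖² = 3`); averaged over a uniform source this says the host of ONE tracer is uniformly
distributed at every intermediate time, under ANY law on phase space. -/
theorem mass_conserved (n : ℕ) (μ : Fin n → ℝ) (e : Event n) (he : e.k ≠ e.l) :
    ∑ m, massStep μ e m = ∑ m, μ m := by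
  rw [sum_twoPoint he μ (massStep μ e) _ _ (fun m => rfl)]
  ring

/-- **Split hazard.** The never-split mass drops by exactly `2p(1-p)ν(k) + 2q(1-q)ν(l)` at each event
(so it tends to `0` iff the hazards met along the common path are not summable). -/
theorem ns_total_step (n : ℕ) (ν : Fin n → ℝ) (e : Event n) (he : e.k ≠ e.l) :
    ∑ m, nsStep ν e m
      = (∑ m, ν m) - (2 * e.p * (1 - e.p) * ν e.k + 2 * e.q * (1 - e.q) * ν e.l) := by
  rw [sum_twoPoint he ν (nsStep ν e) _ _ (fun m => rfl)]
  ring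

/-- **Re-merged mass: same hazard, fed by merges.**  `Σ A' = Σ A − hazard(A) + mergeStep`.  Consequence
used by the line: only merges that are followed by a hazard-free stretch up to the end of the window
survive in `A` — i.e. only LATE re-touches of the two hosts matter. -/
theorem a_total_step (n : ℕ) (μ A : Fin n → ℝ) (e : Event n) (he : e.k ≠ e.l) :
    ∑ m, aStep μ A e m
      = (∑ m, A m) - (2 * e.p * (1 - e.p) * A e.k + 2 * e.q * (1 - e.q) * A e.l) + mergeStep μ e := by
  rw [sum_twoPoint he A (aStep μ A e) _ _ (fun m => rfl)]
  simp only [mergeStep]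
  ring

/-! ### The invariant: together-mass ≤ never-split mass + re-merged mass -/

/-- Invariant along the sequence. -/
def Inv {n : ℕ} (s : State n) : Prop :=
  (∀ m, 0 ≤ s.2.2.1 m) ∧ (∀ m, 0 ≤ s.1 m) ∧ (∀ m, (s.1 m) ^ 2 ≤ s.2.1 m + s.2.2.1 m) ∧
    (∑ m, s.2.2.1 m ≤ s.2.2.2)

theorem inv_init {n : ℕ} (i : Fin n) : Inv (init i) := by
  refine ⟨fun _ => le_rfl, ?_, ?_, by simp [init]⟩
  · intro m
    simp only [init, Pi.single_apply]
    split_ifs <;> norm_num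
  · intro m
    simp only [init, Pi.single_apply]
    split_ifs <;> norm_num

theorem inv_step {n : ℕ} (s : State n) (e : Event n) (he : Admissible e) (hs : Inv s) :
    Inv (run s e) := by
  obtain ⟨hkl, hp0, hp1, hq0, hq1⟩ := he
  obtain ⟨μ, ν, A, B⟩ := s
  obtain ⟨hA, hμ, hinv, hB⟩ := hs
  simp only at hA hμ hinv hB
  refine ⟨?_, ?_, ?_, ?_⟩
  · -- nonnegativity of the re-merged mass
    intro m
    simp only [run, aStep]
    have hkl' := mul_nonneg (hμ e.k) (hμ e.l)
    split_ifs
    · have := hA e.k; have := hA e.l; positivity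
    · have := hA e.k; have := hA e.l; positivity
    · exact hA m
  · -- nonnegativity of the tracer law
    intro m
    simp only [run, massStep]
    split_ifs
    · exact add_nonneg (mul_nonneg (sub_nonneg.2 hp1) (hμ e.k)) (mul_nonneg hq0 (hμ e.l))
    · exact add_nonneg (mul_nonneg (sub_nonneg.2 hq1) (hμ e.l)) (mul_nonneg hp0 (hμ e.k))
    · exact hμ m
  · -- together ≤ never-split + re-merged, pointwise (the pair law is the product law)
    intro m
    simp only [run, massStep, nsStep, aStep]
    have h1 := hinv e.k
    have h2 := hinv e.l
    split_ifs
    · nlinarith [mul_nonneg (sq_nonneg (1 - e.p)) (sub_nonneg.2 h1),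
                 mul_nonneg (sq_nonneg e.q) (sub_nonneg.2 h2)]
    · nlinarith [mul_nonneg (sq_nonneg (1 - e.q)) (sub_nonneg.2 h2),
                 mul_nonneg (sq_nonneg e.p) (sub_nonneg.2 h1)]
    · exact hinv m
  · -- crude: total re-merged mass ≤ accumulated merge bound
    simp only [run]
    rw [a_total_step n μ A e hkl]
    nlinarith [mul_nonneg (mul_nonneg hp0 (sub_nonneg.2 hp1)) (hA e.k),
               mul_nonneg (mul_nonneg hq0 (sub_nonneg.2 hq1)) (hA e.l)]

theorem inv_foldl {n : ℕ} (L : List (Event n)) (hL : ∀ e ∈ L, Admissible e)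
    (s : State n) (hs : Inv s) : Inv (L.foldl run s) := by
  induction L generalizing s with
  | nil => simpa using hs
  | cons e L ih =>
    rw [List.foldl_cons]
    exact ih (fun e' he' => hL e' (List.mem_cons_of_mem _ he')) _ (inv_step s e (hL e (by simp)) hs)

/-- **Coalescent bound, refined (first lemma of the line, proved).**  After ANY admissible exchange
sequence from the source `i`:  together-mass ≤ never-split mass + re-merged mass,
`Σ_m μ(m)² ≤ Σ_m ν(m) + Σ_m A(m)`, where `A` is fed only by host–host re-touches of the two tracers and
decays by the split hazard (`a_total_step`).  For the crux: `E[ipr] ≤ 9·E[Σν] + 9·E[ΣA]`. -/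
theorem coalescent_bound_refined (n : ℕ) (i : Fin n) (L : List (Event n))
    (hL : ∀ e ∈ L, Admissible e) :
    let s := L.foldl run (init i)
    ∑ m, (s.1 m) ^ 2 ≤ (∑ m, s.2.1 m) + ∑ m, s.2.2.1 m := by
  intro s
  obtain ⟨_hA, _hμ, hinv, _hB⟩ : Inv s := inv_foldl L hL _ (inv_init i)
  calc ∑ m, (s.1 m) ^ 2 ≤ ∑ m, (s.2.1 m + s.2.2.1 m) := Finset.sum_le_sum (fun m _ => hinv m)
    _ = (∑ m, s.2.1 m) + ∑ m, s.2.2.1 m := Finset.sum_add_distrib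

/-- **Coalescent bound, crude.**  `Σ_m μ(m)² ≤ Σ_m ν(m) + B`, `B` = total merge mass ever. -/
theorem coalescent_bound (n : ℕ) (i : Fin n) (L : List (Event n)) (hL : ∀ e ∈ L, Admissible e) :
    let s := L.foldl run (init i)
    ∑ m, (s.1 m) ^ 2 ≤ (∑ m, s.2.1 m) + s.2.2.2 := by
  intro s
  obtain ⟨_hA, _hμ, hinv, hB⟩ : Inv s := inv_foldl L hL _ (inv_init i)
  calc ∑ m, (s.1 m) ^ 2 ≤ ∑ m, (s.2.1 m + s.2.2.1 m) := Finset.sum_le_sum (fun m _ => hinv m)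
    _ = (∑ m, s.2.1 m) + ∑ m, s.2.2.1 m := Finset.sum_add_distrib
    _ ≤ (∑ m, s.2.1 m) + s.2.2.2 := by linarith

/-- Mass transport along any admissible sequence. -/
theorem mass_conserved_foldl (n : ℕ) (L : List (Event n)) (hL : ∀ e ∈ L, Admissible e) (s : State n) :
    ∑ m, (L.foldl run s).1 m = ∑ m, s.1 m := by
  induction L generalizing s with
  | nil => simp
  | cons e L ih =>
    rw [List.foldl_cons, ih (fun e' he' => hL e' (List.mem_cons_of_mem _ he'))]
    exact mass_conserved n s.1 e (hL e (by simp)).1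

/-- Never-split mass is pathwise non-increasing along any admissible sequence (the ONLY monotone quantity
the line uses; `Σ μ²` itself is not monotone — merges raise it, cf. negative note N1/N5 on this crux). -/
theorem ns_total_antitone (n : ℕ) (ν : Fin n → ℝ) (hν : ∀ m, 0 ≤ ν m) (e : Event n)
    (he : Admissible e) : ∑ m, nsStep ν e m ≤ ∑ m, ν m := by
  obtain ⟨hkl, hp0, hp1, hq0, hq1⟩ := he
  rw [ns_total_step n ν e hkl]
  nlinarith [mul_nonneg (mul_nonneg hp0 (sub_nonneg.2 hp1)) (hν e.k),
             mul_nonneg (mul_nonneg hq0 (sub_nonneg.2 hq1)) (hν e.l)]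

end Summit.AtomisticToContinuum.HydrodynamicLimit.Cruxes.DiffuseBackwardInfluence.CoalescingTracers
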